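import Summits.QuantumFields.BalabanUV.Beta.FP.NestedDeadRowsOrderTwo
import Summits.QuantumFields.BalabanUV.Beta.FP.NestedColumnCombDeadTower

/-!
# `BalabanUV.Beta.FP.NestedDeadRowsOrderTwoTower` — road «FP» for binder row D1, ROUTE T, (β-dead) ORDER 2 AT THE COMPOSITE DOOR #21 (`j ≥ 2`):
# **THE TOP CHART's FADDEEV–POPOV 2-JET `uTop` OF `FP/NestedStepLawTorusCompositeOneShotTop` IS DEAD UNDER `hdead` ALONE WHEN THE COMPOSITE ORDER-2
# COVARIANCE IMAGE `D̄₂` IS THE PURE SQUARE ON THE TOP COMB** — the instance of my g24 `NestedDeadRowsOrderTwo` §3 at #21's letters, and `hdead` itself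
# discharged for the nested composite column by `NestedColumnCombDeadTower` §1 AT #21's OWN FINE SLICE (the OWNER d1-p3 g25's word W-FP-25-11, journal
# `HOME/CLAIMS.log` l.51441: «#21's `uTop` instance — IT IS YOURS — GO, AS CANDIDATE exactly like U23♭ ∕ I-7»)

WHY.  #21 `NestedStepLawTorusCompositeOneShotTop.secondVar_oneShot_nestedStepLaw_torus_composite_graded_oneShot_of_uTop` (p335338 ✓) displays ONE
slice-side letter, `uTop : secondVar (τ₂ * Dbar) (τ₂ * Db₁) (τ₂ * Db₂) = 0` (`τ₂ = combF Lc M′ (rs 0)` the top comb rows, `Dbar = σ_{n+1} • tgrad M′↾`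
the (COV-m) order-0 image, `Db₁ Db₂` the composite covariance images of its rows `c1 c2`).  leaf-02's (COV-m) tower makes the images explicit: ORDER 1
(`TorusCompositeCovarianceOneRows.torus_c1_tower`, p345008 ✓) `D̄₁(a, t̄) = −(c·(compRows … (n+1) *ᵥ h) a·[t̄ = a.1 + e_{a.2}])` — tip-type along the
transported direction; ORDER 2 (leaf-02 g25 INTENT I-5 `FP/TorusCompositeCovarianceTwoRows.torus_c2_tower`, over the ♭ second chain rule I-4
`TorusCompositeCovarianceTwo.compIns₂_mul_tgrad`, STAGED cc6ff0d5e7ea178c, journal l.51431) `D̄₂(a, t̄) = (c²∕σ_{n+1})·((compRows … (n+1) *ᵥ h) a)²·[t̄ =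
a.1 + e_{a.2}]` — the PURE SQUARE of the transported direction.  My g24 dichotomy (`NestedDeadRowsOrderTwo` §3, p345341 ✓ ∕ p347571 ✓) then says: under the
square law `uTop ⟸ hdead` ALONE (`torus_uTop_of_average_dead_sq`) — no comb-tip residue (the residue `Σ_{tips} v(a_x)∕σ` of `torus_uTop_eq_sum_of_average_dead`
is the cut-(A) price; under (♭) it is absent).  THIS FILE is that instance at #21's letters, and the discharge of `hdead` for the nested composite column.
* §1 **`torus_uTop_tower_of_average_dead_sq`** — #21's `hτ₂ hDbar` VERBATIM (`σ_{n+1} = ∏_{i<n+1} stepScale d Lc (lev (i+1))·#B`, non-zero by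
  `TorusCompositeSlice.prod_stepScale_mul_card_ne_zero`), `Db₁ :=` C2's `D̄₁` VERBATIM (`Matrix.of`, every entry), `Db₂` = ANY matrix whose entries ON THE TOP
  COMB BONDS are `κ(a)·((compRows … *ᵥ h) a)²·[tip]` (any weight `κ`, so I-5's letter in whatever spelling it lands — `(c²∕σ)·x²`, `σ⁻¹·(c·x)²`, … — is ONE
  `ring` away), `hdead : (compRows … (n+1) *ᵥ h) a = 0` at every top comb bond ⟹ `secondVar (τ₂ * Dbar) (τ₂ * Db₁) (τ₂ * Db₂) = 0` — #21's `uTop` BY TERM;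
  `torus_uTop_tower_of_average_dead_of_dead` (the same for ANY order-2 weight `v` vanishing on the top comb — the `t2`-strength clause).
* §2 **`torus_uTop_tower_of_nested_column_sq`** — `hdead` DISCHARGED: for the nested composite column `h := minOp H₀ [compRows; τ₁]·(minOp S₁₁ [Q₂₀; τ₂]·(h̄, 0), 0)`
  of ANY top direction `h̄`, with the fine slice `τ₁` ANY matrix of #21's slice type `NParam Lc (fine Lc M′) (rs ∘ succ) n` (in particular #21's own
  `hτ₁`, the one-shot big comb of the tower BELOW, R-FP-55 (α) — nothing of `τ₁` beyond non-degeneracy is used) and ANY coarse form `S₁₁` ∕ top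
  averaging `Q₂₀`, both KKT systems non-degenerate (#21's `h1`∕`h2` data, displayed as `IsUnit det`): `uTop` with NO deadness hypothesis —
  `NestedColumnCombDeadTower.hdead_of_nested_column_mulVec` (§1 there, fine slice GENERIC) feeds §1 here.
  LOCATED NOTE against my own g24 file (zero weight): `NestedColumnCombDeadTower` §2 `hdead_of_nested_column_tower` binds the fine slice at `bigP Lc M′ rs hrs
  (n+1)` — the `(n+1)`-comb slice of the ONE-SHOT literal (#21's `P`), not #21's nested fine slice `τ₁`; it is a correct theorem (ANY non-degenerate fine
  slice gives `hdead`, §1 there) but not the instance #21's assembly binds — §2 HERE takes `τ₁` at #21's slice TYPE, free.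
* §3 **`torus_uTop_tower_of_c2_letter`** ∕ **`…_nested_column`** — §1∕§2 at leaf-02 I-5's `D̄₂` letter VERBATIM (`Matrix.of fun a t => (c² · σ_{n+1}⁻¹) ·
  ((compRows … (n+1) *ᵥ h) a)² · tdelta M′ (↑a.1 + e_{a.2}) t.1`, every entry; STAGED twin 0e62d8e4ece675b7): the OWNER's `j ≥ 2` assembly closes #21's `uTop`
  slot by ONE `exact` at I-5's `c2`-letters, with or without a displayed `hdead`.
* §4 LABEL-INDEPENDENT (the cut-(A) ∕ priced branch at #21's letters): **`torus_uTop_tower_eq_sum_of_average_dead`** — under `hdead`, for ANY order-2 weight `v`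
  on the top comb, `uTop`'s left side `= Σ_{tip-oriented x} v(a_x) ∕ σ_{n+1}` (ONE scalar per direction), and **`torus_uTop_tower_of_average_dead_of_sum_eq_zero`**
  (`uTop ⟸ hdead ∧ Σ = 0`; R-FP-56 (b) «priced»; under cut (A) `v` carries the `−D̄₂′`-type member — R-FP-62 (iii), my g26 W-7 (2)(b)).  So whichever label PART
  THREE's junction returns, the file serves #21's slot: (♭)∕pure square ⇒ §1–§3 close it outright; cut (A) ⇒ §4 reduces it to the one comb-tip sum.
[folklore] composition BY NAME of two landed files of this lineage; no `def`, no `def … : Prop`, nothing cited, 0 sorry.  AS CANDIDATE (R-FP-63 (iv)∕(v)):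
the (♭) label of leaf-02's `compIns₂` and the identification of the composite jet with Bałaban's are PART THREE's junction's ∕ an2's words — this file
only says what #21's `uTop` slot costs once `D̄₂` IS the pure square on the top comb: nothing beyond `hdead`.  NOT HERE: the rows `c2 ∕ d2` themselves
(leaf-02 I-5), the cut-(A) priced branch (my g22 `CoarseFPDefect` ∕ g24 `torus_uTop_of_average_dead_of_sum_eq_zero`, unchanged), anything of the dictionary.

HONEST DEPENDENCY (page 1, mandatory): continuum YM on T⁴ ⇐ BetaPertH ∧ nine spine estimates (0/9 proved); BetaPertH ⇐ (D1) ∧ (D4) ∧ CAP+tail;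
G-an2-4 gates asym, D1 and NE2/3/4.  HONEST FRAMING (cell contract, verbatim): «discharging `BetaPertH` makes Bałaban's UV stability UNCONDITIONAL —
a real constructive-QFT result; it is NOT the continuum limit and NOT the Clay problem.»  ABSOLUTE RULE (cell charter, verbatim): «No internally-minted
statement may enter as a cited fact. Every hypothesis is either kernel-proved in this package or a verbatim quotation of a PUBLISHED theorem with page
reference. The manuscript(s) under audit are NOT citable for their own disputed steps — they are the thing under adjudication; programme-internal
(2001/route/tribunal) claims are never citable.»  0 estimates; 0∕4 row-D1 binders (hW, hR, D1Tel, D1Rep); NOT the dictionary, NOT (T-ID)∕(T-β)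
complete, NOT SDF, NOT D1, NOT BetaPertH, NOT continuum, NOT Clay.  «not in print; our bookkeeping».
Provenance: D1 formalisation swarm LEAF PROVER 06, unit b2b-balaban-beta-d1-formalise-leaf-06 gen 27, 2026-08-23.  No existing file touched.
-/

noncomputable section

open scoped BigOperators Matrix

namespace Summit.QuantumFields.BalabanUV.Beta.FP.NestedDeadRowsOrderTwoTower

open Matrix Finset
open Literature.MathematicalPhysics.QuantumFieldTheory.Balaban1983to89
open Literature.MathematicalPhysics.QuantumFieldTheory.Balaban1983to89.Beta
open Literature.MathematicalPhysics.QuantumFieldTheory.Balaban1983to89.Beta.Composition (kkt)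
open Literature.MathematicalPhysics.QuantumFieldTheory.Balaban1983to89.Beta.CompositionSingular (minOp)
open AffineAveraging (Site box toSite unitVec)
open B5Prop11Plancherel (fine)
open B6Lemma24Torus (pbox)
open OneStepResolventKernel (Fib)
open Summit.QuantumFields.BalabanUV.Beta.AxialDressingRooted (IsCombBondAt)
open Summit.QuantumFields.BalabanUV.Beta.BorderedHessian (stepScale)
open Summit.QuantumFields.BalabanUV.Beta.D1BFx.LogDetSecondVariation (secondVar)
open Summit.QuantumFields.BalabanUV.Beta.FP.KernelPeriodisationFib (Idx)
open Summit.QuantumFields.BalabanUV.Beta.FP.TorusCombForest (axisOf baseOf tipOf)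
open Summit.QuantumFields.BalabanUV.Beta.FP.TorusCombRows (Res combBondT baseOf_mem_pbox)
open Summit.QuantumFields.BalabanUV.Beta.GAN24.FineReadoutCauchyFrame (toSite_mem_range)
open Summit.QuantumFields.BalabanUV.Beta.FP.TorusGaugeCovariance (tgrad tdelta)
open Summit.QuantumFields.BalabanUV.Beta.FP.TorusCompositeObjects (towerTorus compRows NParam bigP combF)
open Summit.QuantumFields.BalabanUV.Beta.FP.TorusCompositeSlice (prod_stepScale_mul_card_ne_zero)
open Summit.QuantumFields.BalabanUV.Beta.FP.NestedDeadRowsOrderTwo (torus_uTop_of_average_dead_sq torus_uTop_of_average_dead_of_dead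
  torus_uTop_eq_sum_of_average_dead torus_uTop_of_average_dead_of_sum_eq_zero)
open Summit.QuantumFields.BalabanUV.Beta.FP.NestedColumnCombDeadTower (hdead_of_nested_column_mulVec)

variable {d : ℕ} (M' : Fin (d + 1) → ℕ) [∀ μ, NeZero (M' μ)] (Lc : ℕ) [NeZero Lc] (lev : ℕ → ℕ) (rs : ℕ → (Fin (d + 1) → ℕ)) (n : ℕ)

/-! ## §1 #21's `uTop` under `hdead` when `D̄₂` is the pure square on the top comb -/

/-- [folklore] **`torus_uTop_tower_of_average_dead_sq` — #21's `uTop` SLOT ⟸ `hdead` ALONE UNDER THE SQUARE LAW.**  At #21's letters (`hτ₂ hDbar` VERBATIM;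
`Db₁ :=` leaf-02 C2 `torus_c1_tower`'s `D̄₁` VERBATIM; `Db₂` ANY matrix whose TOP-COMB entries are `κ(a)·((compRows … (n+1) *ᵥ h) a)²·[t̄ = a.1 + e_{a.2}]`
— leaf-02 I-5 `torus_c2_tower`'s pure square `(c²∕σ_{n+1})·(…)²` is the case `κ := c²∕σ_{n+1}` everywhere): if the transported direction is
average-dead on the top comb (`hdead`), then `secondVar (τ₂ * Dbar) (τ₂ * Db₁) (τ₂ * Db₂) = 0`.  ONE term of my g24 `NestedDeadRowsOrderTwo.torus_uTop_of_average_dead_sq`. -/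
theorem torus_uTop_tower_of_average_dead_sq (hrs : ∀ k, rs k ∈ box (d + 1) Lc) (hM' : ∀ i, Lc ∣ M' i)
    {τ₂ : Matrix (Res (toSite (rs 0)) Lc M') (↥(pbox M') × Fin (d + 1)) ℝ} (hτ₂ : τ₂ = combF Lc M' (rs 0))
    {Dbar : Matrix (↥(pbox M') × Fin (d + 1)) (Res (toSite (rs 0)) Lc M') ℝ}
    (hDbar : Dbar = (∏ i ∈ range (n + 1), (stepScale d Lc (lev (i + 1)) * ((box (d + 1) Lc).card : ℝ))) •
        (tgrad M').submatrix (fun a : ↥(pbox M') × Fin (d + 1) => ((a.1, Sum.inl a.2) : Idx M' (Fib d))) (fun t : Res (toSite (rs 0)) Lc M' => (t.1 : ↥(pbox M'))))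
    (c : ℝ) (h : ↥(pbox (towerTorus Lc M' (n + 1))) × Fin (d + 1) → ℝ) (κ : ↥(pbox M') × Fin (d + 1) → ℝ)
    {Db₁ : Matrix (↥(pbox M') × Fin (d + 1)) (Res (toSite (rs 0)) Lc M') ℝ}
    (hDb₁ : Db₁ = Matrix.of fun (a : ↥(pbox M') × Fin (d + 1)) (t : Res (toSite (rs 0)) Lc M') =>
        -(c * (compRows Lc M' lev rs (n + 1) *ᵥ h) a * tdelta M' ((a.1 : Site (d + 1)) + unitVec a.2) t.1))
    (Db₂ : Matrix (↥(pbox M') × Fin (d + 1)) (Res (toSite (rs 0)) Lc M') ℝ)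
    (hDb₂ : ∀ a : ↥(pbox M') × Fin (d + 1), IsCombBondAt (toSite (rs 0)) Lc a.2 (a.1 : Site (d + 1)) →
      ∀ t : Res (toSite (rs 0)) Lc M', Db₂ a t = κ a * (compRows Lc M' lev rs (n + 1) *ᵥ h) a ^ 2 * tdelta M' ((a.1 : Site (d + 1)) + unitVec a.2) t.1)
    (hdead : ∀ (a : ↥(pbox M') × Fin (d + 1)) (x : Res (toSite (rs 0)) Lc M'),
      combBondT (toSite (rs 0)) Lc M' x = ((a.1, Sum.inl a.2) : Idx M' (Fib d)) → (compRows Lc M' lev rs (n + 1) *ᵥ h) a = 0) :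
    secondVar (τ₂ * Dbar) (τ₂ * Db₁) (τ₂ * Db₂) = 0 :=
  torus_uTop_of_average_dead_sq M' (hrs 0) hM' hτ₂ (prod_stepScale_mul_card_ne_zero Lc lev (n + 1)) hDbar Db₁ Db₂
    (compRows Lc M' lev rs (n + 1)) h c κ (fun a _ t => by rw [hDb₁]; rfl) hDb₂ hdead

/-- [folklore] **`torus_uTop_tower_of_average_dead_of_dead` — the `t2`-strength clause at #21's letters**: the same with `Db₂`'s top-comb entries
`v(a)·[tip]` for ANY order-2 weight `v` that VANISHES on the top comb bonds (`hv`) — e.g. any `v` carrying a factor `(compRows … *ᵥ h) a` under `hdead`.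
ONE term of `NestedDeadRowsOrderTwo.torus_uTop_of_average_dead_of_dead`. -/
theorem torus_uTop_tower_of_average_dead_of_dead (hrs : ∀ k, rs k ∈ box (d + 1) Lc) (hM' : ∀ i, Lc ∣ M' i)
    {τ₂ : Matrix (Res (toSite (rs 0)) Lc M') (↥(pbox M') × Fin (d + 1)) ℝ} (hτ₂ : τ₂ = combF Lc M' (rs 0))
    {Dbar : Matrix (↥(pbox M') × Fin (d + 1)) (Res (toSite (rs 0)) Lc M') ℝ}
    (hDbar : Dbar = (∏ i ∈ range (n + 1), (stepScale d Lc (lev (i + 1)) * ((box (d + 1) Lc).card : ℝ))) •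
        (tgrad M').submatrix (fun a : ↥(pbox M') × Fin (d + 1) => ((a.1, Sum.inl a.2) : Idx M' (Fib d))) (fun t : Res (toSite (rs 0)) Lc M' => (t.1 : ↥(pbox M'))))
    (c : ℝ) (h : ↥(pbox (towerTorus Lc M' (n + 1))) × Fin (d + 1) → ℝ) (v : ↥(pbox M') × Fin (d + 1) → ℝ)
    {Db₁ : Matrix (↥(pbox M') × Fin (d + 1)) (Res (toSite (rs 0)) Lc M') ℝ}
    (hDb₁ : Db₁ = Matrix.of fun (a : ↥(pbox M') × Fin (d + 1)) (t : Res (toSite (rs 0)) Lc M') =>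
        -(c * (compRows Lc M' lev rs (n + 1) *ᵥ h) a * tdelta M' ((a.1 : Site (d + 1)) + unitVec a.2) t.1))
    (Db₂ : Matrix (↥(pbox M') × Fin (d + 1)) (Res (toSite (rs 0)) Lc M') ℝ)
    (hDb₂ : ∀ a : ↥(pbox M') × Fin (d + 1), IsCombBondAt (toSite (rs 0)) Lc a.2 (a.1 : Site (d + 1)) →
      ∀ t : Res (toSite (rs 0)) Lc M', Db₂ a t = v a * tdelta M' ((a.1 : Site (d + 1)) + unitVec a.2) t.1)
    (hdead : ∀ (a : ↥(pbox M') × Fin (d + 1)) (x : Res (toSite (rs 0)) Lc M'),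
      combBondT (toSite (rs 0)) Lc M' x = ((a.1, Sum.inl a.2) : Idx M' (Fib d)) → (compRows Lc M' lev rs (n + 1) *ᵥ h) a = 0)
    (hv : ∀ (a : ↥(pbox M') × Fin (d + 1)) (x : Res (toSite (rs 0)) Lc M'),
      combBondT (toSite (rs 0)) Lc M' x = ((a.1, Sum.inl a.2) : Idx M' (Fib d)) → v a = 0) :
    secondVar (τ₂ * Dbar) (τ₂ * Db₁) (τ₂ * Db₂) = 0 :=
  torus_uTop_of_average_dead_of_dead M' (hrs 0) hM' hτ₂ (prod_stepScale_mul_card_ne_zero Lc lev (n + 1)) hDbar Db₁ Db₂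
    (compRows Lc M' lev rs (n + 1)) h c v (fun a _ t => by rw [hDb₁]; rfl) hDb₂ hdead hv

/-! ## §2 `hdead` discharged: the nested composite column of any top direction, at #21's OWN fine slice -/

set_option synthInstance.maxSize 1024 in
/-- [folklore] **`torus_uTop_tower_of_nested_column_sq` — #21's `uTop` WITH NO DEADNESS HYPOTHESIS.**  At #21's letters (`hτ₂ hDbar` VERBATIM; the fine
slice `τ₁` ANY matrix of #21's slice type `NParam Lc (fine Lc M′) (rs ∘ succ) n` — in particular #21's `hτ₁`, the one-shot big comb of the tower BELOW,
R-FP-55 (α); no property of `τ₁` beyond the non-degeneracy `h₁` is used), for ANY finest form `H₀`, coarse form `S₁₁` and top averaging rows `Q₂₀` with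
both KKT systems non-degenerate (`h₁ h₂`, #21's `h1 ∕ h2` data; the composite averaging as #21's LETTER `Q₁₀` with `hQ₁₀ : Q₁₀ = compRows …`, P2 §2's
convention, so the assembly passes its own `hQ₁₀ ∕ hI`-side facts), and for every top direction `h̄`: with `h :=` the NESTED composite column
`minOp H₀ [Q₁₀; τ₁]·(minOp S₁₁ [Q₂₀; τ₂]·(h̄, 0), 0)`, `Db₁ :=` C2's `D̄₁` along `h`, and `Db₂` the pure square on the top comb (any weight `κ`),
`secondVar (τ₂ * Dbar) (τ₂ * Db₁) (τ₂ * Db₂) = 0`.  §1 fed by `NestedColumnCombDeadTower.hdead_of_nested_column_mulVec` (fine slice generic). -/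
theorem torus_uTop_tower_of_nested_column_sq (hrs : ∀ k, rs k ∈ box (d + 1) Lc) (hM' : ∀ i, Lc ∣ M' i)
    {κ' : Type*} [Fintype κ'] [DecidableEq κ']
    {τ₂ : Matrix (Res (toSite (rs 0)) Lc M') (↥(pbox M') × Fin (d + 1)) ℝ} (hτ₂ : τ₂ = combF Lc M' (rs 0))
    {Dbar : Matrix (↥(pbox M') × Fin (d + 1)) (Res (toSite (rs 0)) Lc M') ℝ}
    (hDbar : Dbar = (∏ i ∈ range (n + 1), (stepScale d Lc (lev (i + 1)) * ((box (d + 1) Lc).card : ℝ))) •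
        (tgrad M').submatrix (fun a : ↥(pbox M') × Fin (d + 1) => ((a.1, Sum.inl a.2) : Idx M' (Fib d))) (fun t : Res (toSite (rs 0)) Lc M' => (t.1 : ↥(pbox M'))))
    (H₀ : Matrix (↥(pbox (towerTorus Lc M' (n + 1))) × Fin (d + 1)) (↥(pbox (towerTorus Lc M' (n + 1))) × Fin (d + 1)) ℝ)
    (τ₁ : Matrix (NParam Lc (fine Lc M') (fun k => rs (k + 1)) n) (↥(pbox (towerTorus Lc M' (n + 1))) × Fin (d + 1)) ℝ)
    (S₁₁ : Matrix (↥(pbox M') × Fin (d + 1)) (↥(pbox M') × Fin (d + 1)) ℝ) (Q₂₀ : Matrix κ' (↥(pbox M') × Fin (d + 1)) ℝ)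
    {Q₁₀ : Matrix (↥(pbox M') × Fin (d + 1)) (↥(pbox (towerTorus Lc M' (n + 1))) × Fin (d + 1)) ℝ} (hQ₁₀ : Q₁₀ = compRows Lc M' lev rs (n + 1))
    (h₁ : IsUnit (kkt H₀ (fromRows Q₁₀ τ₁)).det) (h₂ : IsUnit (kkt S₁₁ (fromRows Q₂₀ τ₂)).det)
    (hbar : κ' → ℝ)
    {v : ↥(pbox M') × Fin (d + 1) → ℝ} (hv : v = minOp S₁₁ (fromRows Q₂₀ τ₂) *ᵥ Sum.elim hbar 0)
    {h : ↥(pbox (towerTorus Lc M' (n + 1))) × Fin (d + 1) → ℝ} (hh : h = minOp H₀ (fromRows Q₁₀ τ₁) *ᵥ Sum.elim v 0)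
    (c : ℝ) (κ : ↥(pbox M') × Fin (d + 1) → ℝ)
    {Db₁ : Matrix (↥(pbox M') × Fin (d + 1)) (Res (toSite (rs 0)) Lc M') ℝ}
    (hDb₁ : Db₁ = Matrix.of fun (a : ↥(pbox M') × Fin (d + 1)) (t : Res (toSite (rs 0)) Lc M') =>
        -(c * (compRows Lc M' lev rs (n + 1) *ᵥ h) a * tdelta M' ((a.1 : Site (d + 1)) + unitVec a.2) t.1))
    (Db₂ : Matrix (↥(pbox M') × Fin (d + 1)) (Res (toSite (rs 0)) Lc M') ℝ)
    (hDb₂ : ∀ a : ↥(pbox M') × Fin (d + 1), IsCombBondAt (toSite (rs 0)) Lc a.2 (a.1 : Site (d + 1)) →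
      ∀ t : Res (toSite (rs 0)) Lc M', Db₂ a t = κ a * (compRows Lc M' lev rs (n + 1) *ᵥ h) a ^ 2 * tdelta M' ((a.1 : Site (d + 1)) + unitVec a.2) t.1) :
    secondVar (τ₂ * Dbar) (τ₂ * Db₁) (τ₂ * Db₂) = 0 :=
  by
  subst hQ₁₀
  exact torus_uTop_tower_of_average_dead_sq M' Lc lev rs n hrs hM' hτ₂ hDbar c h κ hDb₁ Db₂ hDb₂
    (hdead_of_nested_column_mulVec M' (toSite (rs 0)) H₀ (compRows Lc M' lev rs (n + 1)) τ₁ S₁₁ Q₂₀ hτ₂ h₁ h₂ hbar hv hh)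

/-! ## §3 At leaf-02 I-5's letter of `D̄₂` VERBATIM (`TorusCompositeCovarianceTwoRows.torus_c2_tower`, STAGED 0e62d8e4ece675b7): the global pure square
`D̄₂ = Matrix.of fun a t => (c² · σ_{n+1}⁻¹) · ((compRows … (n+1) *ᵥ h) a)² · tdelta M′ (↑a.1 + e_{a.2}) t.1` -/

/-- [folklore] **`torus_uTop_tower_of_c2_letter`** — §1 at I-5's `D̄₂` VERBATIM (every entry, `κ := c²·σ_{n+1}⁻¹`): #21's `uTop` ⟸ `hdead` alone. -/
theorem torus_uTop_tower_of_c2_letter (hrs : ∀ k, rs k ∈ box (d + 1) Lc) (hM' : ∀ i, Lc ∣ M' i)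
    {τ₂ : Matrix (Res (toSite (rs 0)) Lc M') (↥(pbox M') × Fin (d + 1)) ℝ} (hτ₂ : τ₂ = combF Lc M' (rs 0))
    {Dbar : Matrix (↥(pbox M') × Fin (d + 1)) (Res (toSite (rs 0)) Lc M') ℝ}
    (hDbar : Dbar = (∏ i ∈ range (n + 1), (stepScale d Lc (lev (i + 1)) * ((box (d + 1) Lc).card : ℝ))) •
        (tgrad M').submatrix (fun a : ↥(pbox M') × Fin (d + 1) => ((a.1, Sum.inl a.2) : Idx M' (Fib d))) (fun t : Res (toSite (rs 0)) Lc M' => (t.1 : ↥(pbox M'))))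
    (c : ℝ) (h : ↥(pbox (towerTorus Lc M' (n + 1))) × Fin (d + 1) → ℝ)
    {Db₁ : Matrix (↥(pbox M') × Fin (d + 1)) (Res (toSite (rs 0)) Lc M') ℝ}
    (hDb₁ : Db₁ = Matrix.of fun (a : ↥(pbox M') × Fin (d + 1)) (t : Res (toSite (rs 0)) Lc M') =>
        -(c * (compRows Lc M' lev rs (n + 1) *ᵥ h) a * tdelta M' ((a.1 : Site (d + 1)) + unitVec a.2) t.1))
    {Db₂ : Matrix (↥(pbox M') × Fin (d + 1)) (Res (toSite (rs 0)) Lc M') ℝ}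
    (hDb₂ : Db₂ = Matrix.of fun (a : ↥(pbox M') × Fin (d + 1)) (t : Res (toSite (rs 0)) Lc M') =>
        (c ^ 2 * (∏ i ∈ range (n + 1), (stepScale d Lc (lev (i + 1)) * ((box (d + 1) Lc).card : ℝ)))⁻¹)
          * ((compRows Lc M' lev rs (n + 1) *ᵥ h) a) ^ 2 * tdelta M' ((a.1 : Site (d + 1)) + unitVec a.2) t.1)
    (hdead : ∀ (a : ↥(pbox M') × Fin (d + 1)) (x : Res (toSite (rs 0)) Lc M'),
      combBondT (toSite (rs 0)) Lc M' x = ((a.1, Sum.inl a.2) : Idx M' (Fib d)) → (compRows Lc M' lev rs (n + 1) *ᵥ h) a = 0) :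
    secondVar (τ₂ * Dbar) (τ₂ * Db₁) (τ₂ * Db₂) = 0 :=
  torus_uTop_tower_of_average_dead_sq M' Lc lev rs n hrs hM' hτ₂ hDbar c h
    (fun _ => c ^ 2 * (∏ i ∈ range (n + 1), (stepScale d Lc (lev (i + 1)) * ((box (d + 1) Lc).card : ℝ)))⁻¹) hDb₁ Db₂
    (fun a _ t => by rw [hDb₂]; rfl) hdead

set_option synthInstance.maxSize 1024 in
/-- [folklore] **`torus_uTop_tower_of_c2_letter_nested_column`** — §2 at I-5's `D̄₂` VERBATIM: for the nested composite column of ANY top direction `h̄`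
(fine slice `τ₁` free at #21's slice type, `H₀ S₁₁ Q₂₀` free, `Q₁₀` #21's letter with `hQ₁₀`, `h₁ h₂` the two KKT non-degeneracies), #21's `uTop` with NO
deadness hypothesis. -/
theorem torus_uTop_tower_of_c2_letter_nested_column (hrs : ∀ k, rs k ∈ box (d + 1) Lc) (hM' : ∀ i, Lc ∣ M' i)
    {κ' : Type*} [Fintype κ'] [DecidableEq κ']
    {τ₂ : Matrix (Res (toSite (rs 0)) Lc M') (↥(pbox M') × Fin (d + 1)) ℝ} (hτ₂ : τ₂ = combF Lc M' (rs 0))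
    {Dbar : Matrix (↥(pbox M') × Fin (d + 1)) (Res (toSite (rs 0)) Lc M') ℝ}
    (hDbar : Dbar = (∏ i ∈ range (n + 1), (stepScale d Lc (lev (i + 1)) * ((box (d + 1) Lc).card : ℝ))) •
        (tgrad M').submatrix (fun a : ↥(pbox M') × Fin (d + 1) => ((a.1, Sum.inl a.2) : Idx M' (Fib d))) (fun t : Res (toSite (rs 0)) Lc M' => (t.1 : ↥(pbox M'))))
    (H₀ : Matrix (↥(pbox (towerTorus Lc M' (n + 1))) × Fin (d + 1)) (↥(pbox (towerTorus Lc M' (n + 1))) × Fin (d + 1)) ℝ)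
    (τ₁ : Matrix (NParam Lc (fine Lc M') (fun k => rs (k + 1)) n) (↥(pbox (towerTorus Lc M' (n + 1))) × Fin (d + 1)) ℝ)
    (S₁₁ : Matrix (↥(pbox M') × Fin (d + 1)) (↥(pbox M') × Fin (d + 1)) ℝ) (Q₂₀ : Matrix κ' (↥(pbox M') × Fin (d + 1)) ℝ)
    {Q₁₀ : Matrix (↥(pbox M') × Fin (d + 1)) (↥(pbox (towerTorus Lc M' (n + 1))) × Fin (d + 1)) ℝ} (hQ₁₀ : Q₁₀ = compRows Lc M' lev rs (n + 1))
    (h₁ : IsUnit (kkt H₀ (fromRows Q₁₀ τ₁)).det) (h₂ : IsUnit (kkt S₁₁ (fromRows Q₂₀ τ₂)).det)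
    (hbar : κ' → ℝ)
    {v : ↥(pbox M') × Fin (d + 1) → ℝ} (hv : v = minOp S₁₁ (fromRows Q₂₀ τ₂) *ᵥ Sum.elim hbar 0)
    {h : ↥(pbox (towerTorus Lc M' (n + 1))) × Fin (d + 1) → ℝ} (hh : h = minOp H₀ (fromRows Q₁₀ τ₁) *ᵥ Sum.elim v 0)
    (c : ℝ)
    {Db₁ : Matrix (↥(pbox M') × Fin (d + 1)) (Res (toSite (rs 0)) Lc M') ℝ}
    (hDb₁ : Db₁ = Matrix.of fun (a : ↥(pbox M') × Fin (d + 1)) (t : Res (toSite (rs 0)) Lc M') =>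
        -(c * (compRows Lc M' lev rs (n + 1) *ᵥ h) a * tdelta M' ((a.1 : Site (d + 1)) + unitVec a.2) t.1))
    {Db₂ : Matrix (↥(pbox M') × Fin (d + 1)) (Res (toSite (rs 0)) Lc M') ℝ}
    (hDb₂ : Db₂ = Matrix.of fun (a : ↥(pbox M') × Fin (d + 1)) (t : Res (toSite (rs 0)) Lc M') =>
        (c ^ 2 * (∏ i ∈ range (n + 1), (stepScale d Lc (lev (i + 1)) * ((box (d + 1) Lc).card : ℝ)))⁻¹)
          * ((compRows Lc M' lev rs (n + 1) *ᵥ h) a) ^ 2 * tdelta M' ((a.1 : Site (d + 1)) + unitVec a.2) t.1) :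
    secondVar (τ₂ * Dbar) (τ₂ * Db₁) (τ₂ * Db₂) = 0 :=
  by
  subst hQ₁₀
  exact torus_uTop_tower_of_c2_letter M' Lc lev rs n hrs hM' hτ₂ hDbar c h hDb₁ hDb₂
    (hdead_of_nested_column_mulVec M' (toSite (rs 0)) H₀ (compRows Lc M' lev rs (n + 1)) τ₁ S₁₁ Q₂₀ hτ₂ h₁ h₂ hbar hv hh)

/-! ## §4 Label-independent: under `hdead`, #21's `uTop` IS one comb-tip scalar for ANY order-2 weight on the top comb (the cut-(A) ∕ priced branch,
my g22 `CoarseFPDefect` ∕ g24 `torus_uTop_eq_sum_of_average_dead` at #21's letters) -/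

/-- [folklore] **`torus_uTop_tower_eq_sum_of_average_dead` — #21's `uTop` LEFT SIDE IN CLOSED FORM UNDER `hdead`, ANY ORDER-2 WEIGHT.**  At #21's letters
(`hτ₂ hDbar` VERBATIM, `Db₁ :=` C2's `D̄₁`), if `Db₂`'s TOP-COMB entries are `v(a)·[t̄ = a.1 + e_{a.2}]` for ANY weight `v` (the pure square, or the pure square
PLUS a carried `−D̄₂′`-type member `−c·((Q₁₁h)·h)(a)` under cut (A) — R-FP-62 (iii), my g26 W-7 (2)(b)), then
`secondVar (τ₂ * Dbar) (τ₂ * Db₁) (τ₂ * Db₂) = Σ_{x : tip-oriented residual parameters} v(a_x) ∕ σ_{n+1}` — ONE scalar per direction; so under ANY label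
`uTop ⟺` that comb-tip sum vanishes (next theorem).  ONE term of P1 `torus_uTop_eq_sum_of_average_dead`. -/
theorem torus_uTop_tower_eq_sum_of_average_dead (hrs : ∀ k, rs k ∈ box (d + 1) Lc) (hM' : ∀ i, Lc ∣ M' i)
    {τ₂ : Matrix (Res (toSite (rs 0)) Lc M') (↥(pbox M') × Fin (d + 1)) ℝ} (hτ₂ : τ₂ = combF Lc M' (rs 0))
    {Dbar : Matrix (↥(pbox M') × Fin (d + 1)) (Res (toSite (rs 0)) Lc M') ℝ}
    (hDbar : Dbar = (∏ i ∈ range (n + 1), (stepScale d Lc (lev (i + 1)) * ((box (d + 1) Lc).card : ℝ))) •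
        (tgrad M').submatrix (fun a : ↥(pbox M') × Fin (d + 1) => ((a.1, Sum.inl a.2) : Idx M' (Fib d))) (fun t : Res (toSite (rs 0)) Lc M' => (t.1 : ↥(pbox M'))))
    (c : ℝ) (h : ↥(pbox (towerTorus Lc M' (n + 1))) × Fin (d + 1) → ℝ) (v : ↥(pbox M') × Fin (d + 1) → ℝ)
    {Db₁ : Matrix (↥(pbox M') × Fin (d + 1)) (Res (toSite (rs 0)) Lc M') ℝ}
    (hDb₁ : Db₁ = Matrix.of fun (a : ↥(pbox M') × Fin (d + 1)) (t : Res (toSite (rs 0)) Lc M') =>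
        -(c * (compRows Lc M' lev rs (n + 1) *ᵥ h) a * tdelta M' ((a.1 : Site (d + 1)) + unitVec a.2) t.1))
    (Db₂ : Matrix (↥(pbox M') × Fin (d + 1)) (Res (toSite (rs 0)) Lc M') ℝ)
    (hDb₂ : ∀ a : ↥(pbox M') × Fin (d + 1), IsCombBondAt (toSite (rs 0)) Lc a.2 (a.1 : Site (d + 1)) →
      ∀ t : Res (toSite (rs 0)) Lc M', Db₂ a t = v a * tdelta M' ((a.1 : Site (d + 1)) + unitVec a.2) t.1)
    (hdead : ∀ (a : ↥(pbox M') × Fin (d + 1)) (x : Res (toSite (rs 0)) Lc M'),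
      combBondT (toSite (rs 0)) Lc M' x = ((a.1, Sum.inl a.2) : Idx M' (Fib d)) → (compRows Lc M' lev rs (n + 1) *ᵥ h) a = 0) :
    secondVar (τ₂ * Dbar) (τ₂ * Db₁) (τ₂ * Db₂)
      = ∑ x : Res (toSite (rs 0)) Lc M', if tipOf (toSite (rs 0)) Lc x.site = x.site then
          v (⟨baseOf (toSite (rs 0)) Lc x.site, baseOf_mem_pbox (Nat.pos_of_ne_zero (NeZero.ne Lc)) (toSite_mem_range (hrs 0)) hM' x⟩,
              axisOf (toSite (rs 0)) Lc x.site) / (∏ i ∈ range (n + 1), (stepScale d Lc (lev (i + 1)) * ((box (d + 1) Lc).card : ℝ)))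
        else 0 :=
  torus_uTop_eq_sum_of_average_dead M' (hrs 0) hM' hτ₂ (prod_stepScale_mul_card_ne_zero Lc lev (n + 1)) hDbar Db₁ Db₂
    (compRows Lc M' lev rs (n + 1)) h c v (fun a _ t => by rw [hDb₁]; rfl) hDb₂ hdead

/-- [folklore] **`torus_uTop_tower_of_average_dead_of_sum_eq_zero` — THE PRICED BRANCH AT #21's LETTERS**: under `hdead`, #21's `uTop` follows from the vanishing
of that ONE comb-tip sum (R-FP-56 (b) «priced, not a dead line»; under cut (A) the sum is `−c·Σ_{tips} ((Q₁₁h)·h)(a_x)`-type — D2DET's tabulated entries summed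
over the top comb's tip bonds).  ONE term of P1 `torus_uTop_of_average_dead_of_sum_eq_zero`. -/
theorem torus_uTop_tower_of_average_dead_of_sum_eq_zero (hrs : ∀ k, rs k ∈ box (d + 1) Lc) (hM' : ∀ i, Lc ∣ M' i)
    {τ₂ : Matrix (Res (toSite (rs 0)) Lc M') (↥(pbox M') × Fin (d + 1)) ℝ} (hτ₂ : τ₂ = combF Lc M' (rs 0))
    {Dbar : Matrix (↥(pbox M') × Fin (d + 1)) (Res (toSite (rs 0)) Lc M') ℝ}
    (hDbar : Dbar = (∏ i ∈ range (n + 1), (stepScale d Lc (lev (i + 1)) * ((box (d + 1) Lc).card : ℝ))) •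
        (tgrad M').submatrix (fun a : ↥(pbox M') × Fin (d + 1) => ((a.1, Sum.inl a.2) : Idx M' (Fib d))) (fun t : Res (toSite (rs 0)) Lc M' => (t.1 : ↥(pbox M'))))
    (c : ℝ) (h : ↥(pbox (towerTorus Lc M' (n + 1))) × Fin (d + 1) → ℝ) (v : ↥(pbox M') × Fin (d + 1) → ℝ)
    {Db₁ : Matrix (↥(pbox M') × Fin (d + 1)) (Res (toSite (rs 0)) Lc M') ℝ}
    (hDb₁ : Db₁ = Matrix.of fun (a : ↥(pbox M') × Fin (d + 1)) (t : Res (toSite (rs 0)) Lc M') =>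
        -(c * (compRows Lc M' lev rs (n + 1) *ᵥ h) a * tdelta M' ((a.1 : Site (d + 1)) + unitVec a.2) t.1))
    (Db₂ : Matrix (↥(pbox M') × Fin (d + 1)) (Res (toSite (rs 0)) Lc M') ℝ)
    (hDb₂ : ∀ a : ↥(pbox M') × Fin (d + 1), IsCombBondAt (toSite (rs 0)) Lc a.2 (a.1 : Site (d + 1)) →
      ∀ t : Res (toSite (rs 0)) Lc M', Db₂ a t = v a * tdelta M' ((a.1 : Site (d + 1)) + unitVec a.2) t.1)
    (hdead : ∀ (a : ↥(pbox M') × Fin (d + 1)) (x : Res (toSite (rs 0)) Lc M'),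
      combBondT (toSite (rs 0)) Lc M' x = ((a.1, Sum.inl a.2) : Idx M' (Fib d)) → (compRows Lc M' lev rs (n + 1) *ᵥ h) a = 0)
    (hsum : ∑ x : Res (toSite (rs 0)) Lc M', (if tipOf (toSite (rs 0)) Lc x.site = x.site then
          v (⟨baseOf (toSite (rs 0)) Lc x.site, baseOf_mem_pbox (Nat.pos_of_ne_zero (NeZero.ne Lc)) (toSite_mem_range (hrs 0)) hM' x⟩,
              axisOf (toSite (rs 0)) Lc x.site)
        else 0) = 0) :
    secondVar (τ₂ * Dbar) (τ₂ * Db₁) (τ₂ * Db₂) = 0 :=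
  torus_uTop_of_average_dead_of_sum_eq_zero M' (hrs 0) hM' hτ₂ (prod_stepScale_mul_card_ne_zero Lc lev (n + 1)) hDbar Db₁ Db₂
    (compRows Lc M' lev rs (n + 1)) h c v (fun a _ t => by rw [hDb₁]; rfl) hDb₂ hdead hsum

end Summit.QuantumFields.BalabanUV.Beta.FP.NestedDeadRowsOrderTwoTower

end
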